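import Summits.QuantumFields.BalabanUV.Beta.GAN24.DirichletRingLayerCake
import Summits.QuantumFields.BalabanUV.Beta.GAN24.DirichletRingDecay
import Mathlib.Analysis.Complex.ExponentialBounds
import Mathlib.Algebra.Field.GeomSum

/-!
# `BalabanUV.Beta.GAN24.DirichletRingHessian` — binder row G-an2-4 / (CONV-C), road P2 PART IV, leaf L12 (model), part 3: BINDER (A) AT A RE-ENTRANT
# VERTEX — `Σ_{ρ ≤ 2^{J+3}, x∉Q} ρ·(|∂₁²U|² + |∂₂²U|²) ≤ (8/5)·n·SG_n + (112 + 10⁹/(γ−1))·M_n/n` (unit b2b-balaban-gan24-p2, gen 25, v1)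

HONEST FRAMING (cell contract, verbatim): «discharging `BetaPertH` makes Bałaban's UV stability UNCONDITIONAL — a real constructive-QFT
result; it is NOT the continuum limit and NOT the Clay problem.»  Final step of binder (A) of memo `HOME/b2b-balaban-gan24-p2/gen24/W-FULL-WEIGHTED.md` §2
near ONE re-entrant vertex in MODEL COORDINATES, lattice units (plan `HOME/b2b-balaban-gan24-p2/gen25/RING-LEMMA-KERNEL.md` §6): the layer cake
`DirichletRingLayerCake.weighted_hessian_le_sum` + the decay `DirichletRingDecay.ring_energy_decay` for `Ẽ_4` and every `Ẽ_{20·2^j+1}` + the geometric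
sum `Σ_{j≤J} 2^{j(γ−1)} ≤ 2n^{γ−1}/(γ−1)` (`2^{γ−1} − 1 ≥ (γ−1)·log 2 ≥ (γ−1)/2`):
 * §1 `rpow` bookkeeping (`rpow_base_le_self`, `geom_dyadic_le`);
 * §2 **`weighted_hessian_le`** — for `U = 0` on the quadrant, `ΔU = G` on `Q_n ∖ Q`, `0 < ε`, `1 < γ := (π/3)(1−ε/2)`, `20·2^J + 1 ≤ n`:
   `Σ_{Q_n} offQ·ρ·𝟙[ρ ≤ 2^{J+3}]·(|∂₁²U|²+|∂₂²U|²) ≤ (8/5)·n·SG_n + (112 + 10⁹/(γ−1))·M_n/n`,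
   `M_n = Ẽ_n + (π/(2ε))·SG_n·(n+3)²/(2−γ)`, `SG_n = Σ_{Q_n}‖G‖²`.
In tree units (`r = ρ/n`, `|P_μu|² = n⁴|∂_μ²U|²`, `Ẽ_n ≍ ‖f‖²/n²`, `SG_n ≍ ‖f‖²/n⁴`) both sides are `≍ ‖f‖²/n³`: the weighted Hessian `Σ r|P_μu|²` near the
vertex (rings `ρ ≤ 2^{J+3}`, i.e. `r ≤ 2/5` for the maximal `J`) is bounded by `C(ε)·‖f‖²` uniformly in `n` — the d = 2 content of binder (A); the rings
`r > 1/5` and the transfer to the torus Dirichlet problem are leaf L14 (NOT here).  Constants explicit, not optimised.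

ABSOLUTE RULE (cell, verbatim): «No internally-minted statement may enter as a cited fact. Every hypothesis is either kernel-proved in
this package or a verbatim quotation of a PUBLISHED theorem with page reference. The manuscript(s) under audit are NOT citable for
their own disputed steps — they are the thing under adjudication; programme-internal (2001/route/tribunal) claims are never citable.»
[folklore] finite sums + elementary real analysis; nothing printed is a hypothesis.  NOT CLAIMED: (A)/(B) on the torus (L14), NE2, (CONV-C), `BetaPertH`,
continuum, Clay.  «not in print; our proof attempt».  HONEST DEPENDENCY: continuum YM on T⁴ ⇐ BetaPertH ∧ nine spine estimates (0/9 proved); BetaPertH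
⇐ (D1) ∧ (D4) ∧ CAP+tail; G-an2-4 gates asym, D1 and NE2/3/4.
-/

noncomputable section

open scoped BigOperators
open Finset

namespace Summit.QuantumFields.BalabanUV.Beta.GAN24.DirichletRingHessian

open DirichletRingEnergies (Et sqSum lap Et_nonneg sqSum_nonneg)
open DirichletRingHessianIdentity (d1 d2 offQ)
open DirichletRingLayerCake (wJ weighted_hessian_le_sum)
open DirichletRingDecay (ring_energy_decay)

variable (U : ℤ → ℤ → ℂ)

/-! ## §1 `rpow` bookkeeping -/

/-- for `0 < x ≤ 1` and `1 ≤ γ`: `x^γ ≤ x`. [folklore] -/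
theorem rpow_base_le_self {x γ : ℝ} (hx0 : 0 < x) (hx1 : x ≤ 1) (hγ : 1 ≤ γ) : x ^ γ ≤ x := by
  have h := Real.rpow_le_rpow_of_exponent_ge hx0 hx1 hγ
  rwa [Real.rpow_one] at h

/-- **the geometric sum of the dyadic weights**: for `0 < s` and `2^{J+1} ≤ n`:  `Σ_{j<J+1} (2^j)^s ≤ 2·n^s/s`
(`2^s − 1 ≥ s·log 2 ≥ s/2`). [folklore] -/
theorem geom_dyadic_le {s : ℝ} (hs0 : 0 < s) {J n : ℕ} (hJn : 2 ^ (J + 1) ≤ n) :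
    ∑ j ∈ range (J + 1), ((2 : ℝ) ^ j) ^ s ≤ 2 * (n : ℝ) ^ s / s := by
  -- `(2^j)^s = (2^s)^j` (the tree has it as `Literature.Probability.RandomPlanarGeometry.two_pow_rpow_comm`; re-derived locally to keep
  -- the imports topical)
  have dy : ∀ j : ℕ, ((2 : ℝ) ^ j) ^ s = ((2 : ℝ) ^ s) ^ j := fun j => by
    rw [← Real.rpow_natCast 2 j, ← Real.rpow_mul (by norm_num), mul_comm, Real.rpow_mul (by norm_num), Real.rpow_natCast]
  set r : ℝ := (2 : ℝ) ^ s with hr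
  have hr1 : 1 < r := Real.one_lt_rpow (by norm_num) hs0
  have hr0 : 0 < r := by linarith
  -- `r − 1 ≥ s/2`
  have hgap : s / 2 ≤ r - 1 := by
    have e : r = Real.exp (Real.log 2 * s) := by rw [hr, Real.rpow_def_of_pos (by norm_num)]
    have h1 := Real.add_one_le_exp (Real.log 2 * s)
    have h2 := Real.log_two_gt_d9
    nlinarith [h1, h2, e.le, e.ge]
  -- the sum
  have hsum : ∑ j ∈ range (J + 1), ((2 : ℝ) ^ j) ^ s = (r ^ (J + 1) - 1) / (r - 1) := by
    rw [← geom_sum_eq hr1.ne' (J + 1)]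
    exact sum_congr rfl fun j _ => dy j
  -- `r^{J+1} = (2^{J+1})^s ≤ n^s`
  have hpow : r ^ (J + 1) ≤ (n : ℝ) ^ s := by
    rw [hr, ← dy (J + 1)]
    exact Real.rpow_le_rpow (by positivity) (by exact_mod_cast hJn) hs0.le
  rw [hsum]
  have hn0 : 0 ≤ (n : ℝ) ^ s := Real.rpow_nonneg (Nat.cast_nonneg n) s
  rw [div_le_div_iff₀ (by linarith) hs0]
  nlinarith [hgap, hpow, hn0, hs0]

/-! ## §2 Binder (A) at a re-entrant vertex (model) -/

/-- **BINDER (A) AT A RE-ENTRANT VERTEX (model coordinates, lattice units)**: let `U : ℤ → ℤ → ℂ` vanish on the quadrant, `ΔU = G` on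
`Q_n ∖ Q`, `0 < ε`, `1 < γ := (π/3)(1−ε/2)`, and `20·2^J + 1 ≤ n`.  Then, with `M_n = Ẽ_n + (π/(2ε))·SG_n·(n+3)²/(2−γ)`,
`Σ_{Q_n} offQ·ρ·𝟙[ρ ≤ 2^{J+3}]·(|∂₁²U|²+|∂₂²U|²) ≤ (8/5)·n·SG_n + (112 + 10⁹/(γ−1))·M_n/n`. [folklore] -/
theorem weighted_hessian_le {n J : ℕ} (hJ : 20 * 2 ^ J + 1 ≤ n) (G : ℤ → ℤ → ℂ)
    (hU : ∀ s t : ℤ, 0 ≤ s → 0 ≤ t → U s t = 0)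
    (hEq : ∀ i j : ℤ, -(n : ℤ) ≤ i → i < n → -(n : ℤ) ≤ j → j < n → ¬(0 ≤ i ∧ 0 ≤ j) → lap U i j = G i j)
    {ε : ℝ} (hε : 0 < ε) (hγ : 1 < Real.pi / 3 * (1 - ε / 2)) :
    sqSum (fun i j => offQ i j * wJ J i j * (‖d1 U i j‖ ^ 2 + ‖d2 U i j‖ ^ 2)) n
      ≤ 8 / 5 * n * sqSum (fun i j => ‖G i j‖ ^ 2) n
        + (112 + 10 ^ 9 / (Real.pi / 3 * (1 - ε / 2) - 1))
          * (Et U n + (Real.pi / (2 * ε) * sqSum (fun i j => ‖G i j‖ ^ 2) n) * ((n : ℝ) + 3) ^ 2 / (2 - Real.pi / 3 * (1 - ε / 2))) / n := by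
  have hX1 : 1 ≤ 2 ^ J := Nat.one_le_two_pow
  have hn21 : 21 ≤ n := by omega
  -- the inputs, taken BEFORE the abbreviations so that `set` rewrites them
  have hLC := weighted_hessian_le_sum U hJ G hU hEq
  have hdec4 := ring_energy_decay U G hU hEq hε hγ (show 4 ≤ n by omega) le_rfl
  have hdecL : ∀ L : ℕ, 20 * L + 1 ≤ n → Et U (20 * L + 1)
      ≤ ((((20 * L + 1 : ℕ) : ℝ) + 3) / ((n : ℝ) + 3)) ^ (Real.pi / 3 * (1 - ε / 2))
        * (Et U n + (Real.pi / (2 * ε) * sqSum (fun i j => ‖G i j‖ ^ 2) n) * ((n : ℝ) + 3) ^ 2 / (2 - Real.pi / 3 * (1 - ε / 2))) :=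
    fun L h => ring_energy_decay U G hU hEq hε hγ h le_rfl
  set γ : ℝ := Real.pi / 3 * (1 - ε / 2) with hγdef
  set SG : ℝ := sqSum (fun i j => ‖G i j‖ ^ 2) n with hSG
  set M : ℝ := Et U n + (Real.pi / (2 * ε) * SG) * ((n : ℝ) + 3) ^ 2 / (2 - γ) with hM
  have hπ3 := Real.pi_gt_three
  have hπ4 := Real.pi_lt_four
  have hε2 : ε < 2 := by
    by_contra h
    have : Real.pi / 3 * (1 - ε / 2) ≤ 0 := mul_nonpos_of_nonneg_of_nonpos (by positivity) (by linarith)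
    linarith
  have hγ2 : γ < 2 := by
    have : Real.pi / 3 * (1 - ε / 2) < Real.pi / 3 * 1 := mul_lt_mul_of_pos_left (by linarith) (by positivity)
    rw [hγdef]; linarith
  have hγ1 : 0 < γ - 1 := by rw [hγdef]; linarith
  have hγne : γ - 1 ≠ 0 := hγ1.ne'
  have hnR : (21 : ℝ) ≤ n := by exact_mod_cast hn21
  have hn0 : (0 : ℝ) < n := by linarith
  have hnγ : (n : ℝ) ^ γ ≠ 0 := (Real.rpow_pos_of_pos hn0 γ).ne'
  have hSG0 : 0 ≤ SG := sqSum_nonneg _ (fun _ _ => sq_nonneg _) _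
  have hM0 : 0 ≤ M := by
    have := Et_nonneg U n
    have h2 : 0 < 2 - γ := by linarith
    positivity
  -- (1) the innermost rings: `16·Ẽ_4 ≤ 112·M/n`
  have h4 : 16 * Et U 4 ≤ 112 * M / n := by
    have hb0 : (0 : ℝ) < ((4 : ℕ) : ℝ) + 3 := by norm_num
    have hratio : (((4 : ℕ) : ℝ) + 3) / ((n : ℝ) + 3) ≤ 7 / n := by
      rw [div_le_div_iff₀ (by positivity) hn0]; push_cast; nlinarith
    have hbase1 : (((4 : ℕ) : ℝ) + 3) / ((n : ℝ) + 3) ≤ 1 := by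
      rw [div_le_one (by positivity)]; push_cast; linarith
    have hrp : ((((4 : ℕ) : ℝ) + 3) / ((n : ℝ) + 3)) ^ γ ≤ 7 / n :=
      (rpow_base_le_self (by positivity) hbase1 (by linarith)).trans hratio
    calc 16 * Et U 4 ≤ 16 * (((((4 : ℕ) : ℝ) + 3) / ((n : ℝ) + 3)) ^ γ * M) := by linarith [hdec4]
      _ ≤ 16 * (7 / n * M) := by gcongr
      _ = 112 * M / n := by ring
  -- (2) the `SG` part: `Σ_j 2^{j+3}·2·SG = 16·SG·(2^{J+1} − 1) ≤ (8/5)·n·SG`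
  have hgeo2 : ∑ j ∈ range (J + 1), (2 : ℝ) ^ j = (2 : ℝ) ^ (J + 1) - 1 := by
    rw [geom_sum_eq (by norm_num : (2 : ℝ) ≠ 1)]; norm_num
  have hJR : (2 : ℝ) ^ (J + 1) ≤ (n : ℝ) / 10 := by
    rw [le_div_iff₀ (by norm_num)]
    have : ((2 ^ (J + 1) * 10 : ℕ) : ℝ) ≤ n := by exact_mod_cast (by rw [pow_succ]; omega)
    push_cast at this; linarith
  have hSGpart : ∑ j ∈ range (J + 1), (2 : ℝ) ^ (j + 3) * (2 * SG) ≤ 8 / 5 * n * SG := by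
    have e : ∑ j ∈ range (J + 1), (2 : ℝ) ^ (j + 3) * (2 * SG) = 16 * SG * ∑ j ∈ range (J + 1), (2 : ℝ) ^ j := by
      rw [mul_sum]; exact sum_congr rfl fun j _ => by ring
    rw [e, hgeo2]
    nlinarith [hJR, hSG0]
  -- (3) the energy part: `Σ_j 2^{j+3}·84800/(2^j)²·Ẽ_{20·2^j+1} ≤ 8·84800·(24/n)^γ·M·Σ_j (2^j)^{γ−1}`
  have hEpart : ∀ j ∈ range (J + 1), (2 : ℝ) ^ (j + 3) * (84800 / (((2 ^ j : ℕ) : ℝ)) ^ 2 * Et U (20 * 2 ^ j + 1))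
      ≤ 8 * 84800 * ((24 / (n : ℝ)) ^ γ * M) * ((2 : ℝ) ^ j) ^ (γ - 1) := by
    intro j hj
    have hj' := mem_range.mp hj
    have hL1 : 1 ≤ 2 ^ j := Nat.one_le_two_pow
    have hLn : 20 * 2 ^ j + 1 ≤ n := le_trans (by
      have := Nat.pow_le_pow_right (show 0 < 2 by norm_num) (show j ≤ J by omega); omega) hJ
    have hdec := hdecL (2 ^ j) hLn
    have hLR : (1 : ℝ) ≤ (2 : ℝ) ^ j := by exact_mod_cast hL1
    have hL0 : (0 : ℝ) < (2 : ℝ) ^ j := by positivity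
    -- the base of the decay factor
    have hbase : (((20 * 2 ^ j + 1 : ℕ) : ℝ) + 3) / ((n : ℝ) + 3) ≤ 24 * (2 : ℝ) ^ j / n := by
      rw [div_le_div_iff₀ (by positivity) hn0]; push_cast
      nlinarith [mul_nonneg (sub_nonneg.2 hLR) hn0.le]
    have hrp : ((((20 * 2 ^ j + 1 : ℕ) : ℝ) + 3) / ((n : ℝ) + 3)) ^ γ ≤ (24 / (n : ℝ)) ^ γ * ((2 : ℝ) ^ j) ^ γ := by
      rw [← Real.mul_rpow (by positivity) hL0.le, ← mul_div_right_comm]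
      exact Real.rpow_le_rpow (by positivity) hbase (by linarith)
    have hEt : Et U (20 * 2 ^ j + 1) ≤ (24 / (n : ℝ)) ^ γ * ((2 : ℝ) ^ j) ^ γ * M :=
      hdec.trans (mul_le_mul_of_nonneg_right hrp hM0)
    -- `2^{j+3}·84800/(2^j)² = 8·84800/2^j` and `(2^j)^γ/2^j = (2^j)^{γ−1}`
    have e1 : (2 : ℝ) ^ (j + 3) * (84800 / (((2 ^ j : ℕ) : ℝ)) ^ 2 * Et U (20 * 2 ^ j + 1))
        = 8 * 84800 * (Et U (20 * 2 ^ j + 1) / (2 : ℝ) ^ j) := by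
      push_cast; field_simp; ring
    have e2 : ((2 : ℝ) ^ j) ^ (γ - 1) = ((2 : ℝ) ^ j) ^ γ / (2 : ℝ) ^ j := Real.rpow_sub_one hL0.ne' γ
    rw [e1, e2]
    have h0 : 0 ≤ (24 / (n : ℝ)) ^ γ := Real.rpow_nonneg (by positivity) γ
    rw [show 8 * 84800 * ((24 / (n : ℝ)) ^ γ * M) * (((2 : ℝ) ^ j) ^ γ / (2 : ℝ) ^ j)
        = 8 * 84800 * (((24 / (n : ℝ)) ^ γ * ((2 : ℝ) ^ j) ^ γ * M) / (2 : ℝ) ^ j) by ring]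
    exact mul_le_mul_of_nonneg_left (div_le_div_of_nonneg_right hEt hL0.le) (by norm_num)
  have hgeom := geom_dyadic_le hγ1 (J := J) (n := n) (by
    have : 2 ^ (J + 1) * 10 ≤ n := by rw [pow_succ]; omega
    exact le_trans (Nat.le_mul_of_pos_right _ (by norm_num)) this)
  have h24 : (24 / (n : ℝ)) ^ γ ≤ 576 / (n : ℝ) ^ γ := by
    rw [Real.div_rpow (by norm_num) hn0.le]
    refine div_le_div_of_nonneg_right ?_ (Real.rpow_nonneg hn0.le γ)
    calc (24 : ℝ) ^ γ ≤ (24 : ℝ) ^ (2 : ℝ) := Real.rpow_le_rpow_of_exponent_le (by norm_num) hγ2.le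
      _ = 576 := by rw [Real.rpow_two]; norm_num
  have hnpow : (n : ℝ) ^ (γ - 1) / (n : ℝ) ^ γ = 1 / n := by
    rw [Real.rpow_sub_one hn0.ne']
    field_simp
  have hEsum : ∑ j ∈ range (J + 1), (2 : ℝ) ^ (j + 3) * (84800 / (((2 ^ j : ℕ) : ℝ)) ^ 2 * Et U (20 * 2 ^ j + 1))
      ≤ 10 ^ 9 / (γ - 1) * M / n := by
    calc ∑ j ∈ range (J + 1), (2 : ℝ) ^ (j + 3) * (84800 / (((2 ^ j : ℕ) : ℝ)) ^ 2 * Et U (20 * 2 ^ j + 1))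
        ≤ ∑ j ∈ range (J + 1), 8 * 84800 * ((24 / (n : ℝ)) ^ γ * M) * ((2 : ℝ) ^ j) ^ (γ - 1) := sum_le_sum hEpart
      _ = 8 * 84800 * ((24 / (n : ℝ)) ^ γ * M) * ∑ j ∈ range (J + 1), ((2 : ℝ) ^ j) ^ (γ - 1) := by rw [mul_sum]
      _ ≤ 8 * 84800 * ((576 / (n : ℝ) ^ γ) * M) * (2 * (n : ℝ) ^ (γ - 1) / (γ - 1)) := by
          have h0 : 0 ≤ ∑ j ∈ range (J + 1), ((2 : ℝ) ^ j) ^ (γ - 1) := sum_nonneg fun j _ => Real.rpow_nonneg (by positivity) _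
          gcongr
      _ = (8 * 84800 * 576 * 2) / (γ - 1) * M * ((n : ℝ) ^ (γ - 1) / (n : ℝ) ^ γ) := by
          field_simp
      _ = (8 * 84800 * 576 * 2) / (γ - 1) * M / n := by rw [hnpow]; ring
      _ ≤ 10 ^ 9 / (γ - 1) * M / n := by
          have : (8 * 84800 * 576 * 2 : ℝ) ≤ 10 ^ 9 := by norm_num
          have hMn : 0 ≤ M / n := by positivity
          have e : ∀ c : ℝ, c / (γ - 1) * M / n = c * (M / n / (γ - 1)) := fun c => by field_simp
          rw [e, e]
          exact mul_le_mul_of_nonneg_right this (by positivity)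
  -- assemble
  have hsplit : ∑ j ∈ range (J + 1), (2 : ℝ) ^ (j + 3) * (2 * SG + 84800 / (((2 ^ j : ℕ) : ℝ)) ^ 2 * Et U (20 * 2 ^ j + 1))
      = ∑ j ∈ range (J + 1), (2 : ℝ) ^ (j + 3) * (2 * SG)
        + ∑ j ∈ range (J + 1), (2 : ℝ) ^ (j + 3) * (84800 / (((2 ^ j : ℕ) : ℝ)) ^ 2 * Et U (20 * 2 ^ j + 1)) := by
    rw [← sum_add_distrib]; exact sum_congr rfl fun j _ => by ring
  have hfin : 16 * Et U 4 + ∑ j ∈ range (J + 1), (2 : ℝ) ^ (j + 3) * (2 * SG + 84800 / (((2 ^ j : ℕ) : ℝ)) ^ 2 * Et U (20 * 2 ^ j + 1))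
      ≤ 8 / 5 * n * SG + (112 + 10 ^ 9 / (γ - 1)) * M / n := by
    rw [hsplit]
    have e : (112 + 10 ^ 9 / (γ - 1)) * M / n = 112 * M / n + 10 ^ 9 / (γ - 1) * M / n := by ring
    rw [e]
    linarith [h4, hSGpart, hEsum]
  exact hLC.trans hfin

end Summit.QuantumFields.BalabanUV.Beta.GAN24.DirichletRingHessian

end
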